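import Mathlib.Analysis.InnerProductSpace.JointEigenspace
import Mathlib.Analysis.Matrix.Order
import Mathlib.LinearAlgebra.Complex.Module

/-!
# Stub `stub_weightDecomp` of the line `SketchIdeator1` for the crux `BrascampLiebVacuumSC`
# (stmt-QuantumFields-16404, route `ConvexGribovBody`)

Joint weight decomposition of the complexification `L_ℂ = span_ℂ L ⊆ M_N(ℂ)` of a bracket-closed
real subspace `L ⊆ 𝔲(N)` under an abelian `A ≤ L` (pure linear algebra, Mathlib only, no
definitions; the helpers are stated for `Matrix n n ℂ`, `n` a finite type):

* `WeightDecomp.le_iSup_jointEigenspace`: a commuting family of `ℂ`-linear operators of `M_n(ℂ)`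
  that are skew-adjoint for the Hilbert–Schmidt form `tr (Zᴴ W)` and preserve a subspace `V`
  exhausts `V` by joint eigenvectors with eigenvalues `i·χ`, `χ` real — the Hilbert–Schmidt inner
  product is put on `M_n(ℂ)` INSIDE the proof (`InnerProductSpace.ofCore`; Mathlib has no global
  norm on matrices), then `LinearMap.IsSymmetric.iSup_iInf_eq_top_of_commute` is applied to the
  symmetric family `i·f|_V`, whose spectrum is real
  (`LinearMap.IsSymmetric.conj_eigenvalue_eq_self`);
* the weight spaces `E_w = {Z ∈ L_ℂ : [H, Z] = i·w(H) Z ∀ H ∈ A}` are handled through their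
  membership characterisation `hE` (the family `E` itself is built inside `stub_weightDecomp`):
  bracket `[E_w, E_w'] ⊆ E_{w+w'}` (derivation identity), conjugation `−(E_w)ᴴ ⊆ E_{−w}`,
  independence (the `E_w` sit in the independent joint generalised eigenspaces of the commuting
  family `ad H_i`, `H_i` a basis of `A` —
  `Module.End.independent_iInf_maxGenEigenspace_of_forall_mapsTo`), finiteness
  (`WellFoundedGT.finite_ne_bot_of_iSupIndep`), exhaustion and non-degeneracy.

The real-structure hypothesis of the stub is not needed (closure of `L_ℂ` under the bracket and
under `Z ↦ −Zᴴ` follows by span induction). No named facts are used.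
-/

set_option autoImplicit false

open scoped Matrix

noncomputable section

namespace Summit.QuantumFields.YangMills.Theorems.BrascampLiebVacuumSC

namespace WeightDecomp

variable {n : Type*} [Fintype n]

open scoped ComplexOrder in
/-- **Joint diagonalisation.** A commuting family of `ℂ`-linear operators on `M_n(ℂ)` that are
skew-adjoint for the Hilbert–Schmidt form `tr (Zᴴ W)` and preserve a subspace `V` exhausts `V` by
joint eigenvectors with purely imaginary eigenvalues `i·χ`, `χ` real
(`LinearMap.IsSymmetric.iSup_iInf_eq_top_of_commute` for the symmetric family `i·f` on `V`, the
Hilbert–Schmidt inner product `⟪Z, W⟫ = tr (Zᴴ W)` being installed locally). [folklore] -/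
theorem le_iSup_jointEigenspace {ι : Type*} (V : Submodule ℂ (Matrix n n ℂ))
    (f : ι → Matrix n n ℂ →ₗ[ℂ] Matrix n n ℂ) (hV : ∀ i, ∀ Z ∈ V, f i Z ∈ V)
    (hcomm : ∀ i j, Commute (f i) (f j))
    (hskew : ∀ i, ∀ Z W : Matrix n n ℂ, ((f i Z)ᴴ * W).trace = -((Zᴴ * f i W).trace)) :
    V ≤ ⨆ χ : ι → ℝ, V ⊓ ⨅ i, Module.End.eigenspace (f i) (((χ i : ℝ) : ℂ) * Complex.I) := by
  -- the Hilbert–Schmidt inner product space structure on `M_n(ℂ)`, locally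
  let core : InnerProductSpace.Core ℂ (Matrix n n ℂ) :=
    { inner := fun Z W => (Zᴴ * W).trace
      conj_inner_symm := fun Z W => by
        simp only [starRingEnd_apply, ← Matrix.trace_conjTranspose, Matrix.conjTranspose_mul,
          Matrix.conjTranspose_conjTranspose]
      re_inner_nonneg := fun Z =>
        (Complex.nonneg_iff.mp (Matrix.posSemidef_conjTranspose_mul_self Z).trace_nonneg).1
      add_left := fun X Y W => by
        simp only [Matrix.conjTranspose_add, Matrix.add_mul, Matrix.trace_add]
      smul_left := fun X W c => by
        simp only [Matrix.conjTranspose_smul, Matrix.smul_mul, Matrix.trace_smul, smul_eq_mul,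
          starRingEnd_apply]
      definite := fun Z hZ => Matrix.trace_conjTranspose_mul_self_eq_zero_iff.mp hZ }
  letI : NormedAddCommGroup (Matrix n n ℂ) :=
    @InnerProductSpace.Core.toNormedAddCommGroup ℂ (Matrix n n ℂ) _ _ _ core
  letI : InnerProductSpace ℂ (Matrix n n ℂ) := InnerProductSpace.ofCore _
  have hs_inner : ∀ Z W : Matrix n n ℂ, inner ℂ Z W = (Zᴴ * W).trace := fun _ _ => rfl
  -- the symmetric commuting family `T i = i • f i |_V`
  let T : ι → ↥V →ₗ[ℂ] ↥V :=
    fun i => (Complex.I • f i).restrict fun Z hZ => V.smul_mem _ (hV i Z hZ)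
  have hTc : ∀ i (z : ↥V), ((T i z : ↥V) : Matrix n n ℂ) = Complex.I • f i z := fun i z => rfl
  have hT : ∀ i, (T i).IsSymmetric := by
    intro i x y
    rw [Submodule.coe_inner, Submodule.coe_inner, hTc, hTc, inner_smul_left, inner_smul_right,
      hs_inner, hs_inner, hskew i, Complex.conj_I]
    ring
  have hC : Pairwise (Function.onFun Commute T) := by
    intro i j _
    refine LinearMap.ext fun x => Subtype.ext ?_
    simp only [Module.End.mul_apply, hTc, map_smul]
    rw [show f i (f j x) = f j (f i x) from LinearMap.congr_fun (hcomm i j).eq x]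
  have htop := LinearMap.IsSymmetric.iSup_iInf_eq_top_of_commute hT hC
  intro Z hZ
  have hmem : (⟨Z, hZ⟩ : ↥V) ∈ ⨆ χ : ι → ℂ, ⨅ i, Module.End.eigenspace (T i) (χ i) := by
    rw [htop]; exact Submodule.mem_top
  refine Submodule.iSup_induction (motive := fun z : ↥V => (z : Matrix n n ℂ) ∈
      ⨆ χ : ι → ℝ, V ⊓ ⨅ i, Module.End.eigenspace (f i) (((χ i : ℝ) : ℂ) * Complex.I)) _ hmem
    ?_ (by simp) (fun x y hx hy => by simpa using Submodule.add_mem _ hx hy)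
  intro χ z hz
  by_cases hz0 : z = 0
  · simp [hz0]
  have hzi : ∀ i, z ∈ Module.End.eigenspace (T i) (χ i) :=
    fun i => (Submodule.mem_iInf _).mp hz i
  -- symmetric operators have real eigenvalues
  have hreal : ∀ i, (((χ i).re : ℝ) : ℂ) = χ i := fun i =>
    Complex.conj_eq_iff_re.mp
      ((hT i).conj_eigenvalue_eq_self (Module.End.hasEigenvalue_of_hasEigenvector ⟨hzi i, hz0⟩))
  refine Submodule.mem_iSup_of_mem (fun i => -(χ i).re)
    ⟨z.2, (Submodule.mem_iInf _).mpr fun i => ?_⟩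
  rw [Module.End.mem_eigenspace_iff]
  have h1 : Complex.I • f i z = χ i • (z : Matrix n n ℂ) := by
    have := congrArg Subtype.val (Module.End.mem_eigenspace_iff.mp (hzi i))
    simpa [hTc] using this
  have h2 : f i z = (-Complex.I * χ i) • (z : Matrix n n ℂ) := by
    rw [← smul_smul, ← h1, smul_smul]; simp
  rw [h2, Complex.ofReal_neg, hreal i, neg_mul, neg_mul, mul_comm]

/-! ### The adjoint action `ad H = mulLeft H − mulRight H` and bracket-closed spans -/

/-- `(mulLeft H − mulRight H) Z = HZ − ZH`. [folklore] -/
theorem ad_apply (H Z : Matrix n n ℂ) :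
    (LinearMap.mulLeft ℂ H - LinearMap.mulRight ℂ H) Z = H * Z - Z * H := rfl

/-- Commuting matrices have commuting adjoint actions: `[ad X, ad Y] = ad [X, Y] = 0`.
[folklore] -/
theorem commute_ad {X Y : Matrix n n ℂ} (h : X * Y = Y * X) :
    Commute (LinearMap.mulLeft ℂ X - LinearMap.mulRight ℂ X)
      (LinearMap.mulLeft ℂ Y - LinearMap.mulRight ℂ Y) := by
  refine LinearMap.ext fun Z => ?_
  rw [Module.End.mul_apply, Module.End.mul_apply]
  simp only [ad_apply, mul_sub, sub_mul, mul_assoc]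
  rw [show X * (Y * Z) = Y * (X * Z) by rw [← mul_assoc, h, mul_assoc], h]
  abel

/-- `ad H` is skew-adjoint for the Hilbert–Schmidt form when `Hᴴ = −H`:
`tr ((ad H Z)ᴴ W) = − tr (Zᴴ · ad H W)`. [folklore] -/
theorem trace_ad_skew {H : Matrix n n ℂ} (hH : star H = -H) (Z W : Matrix n n ℂ) :
    (((LinearMap.mulLeft ℂ H - LinearMap.mulRight ℂ H) Z)ᴴ * W).trace =
      -((Zᴴ * (LinearMap.mulLeft ℂ H - LinearMap.mulRight ℂ H) W).trace) := by
  rw [Matrix.star_eq_conjTranspose] at hH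
  simp only [ad_apply, Matrix.conjTranspose_sub, Matrix.conjTranspose_mul, hH, Matrix.sub_mul,
    Matrix.mul_sub, Matrix.trace_sub, Matrix.mul_neg, Matrix.neg_mul, Matrix.trace_neg,
    Matrix.mul_assoc]
  rw [Matrix.trace_mul_comm H (Zᴴ * W), Matrix.mul_assoc]
  abel

/-- The complex span of a bracket-closed real subspace is bracket-closed. [folklore] -/
theorem bracket_mem_span {L : Submodule ℝ (Matrix n n ℂ)}
    (hbr : ∀ X ∈ L, ∀ Y ∈ L, X * Y - Y * X ∈ L) {Z W : Matrix n n ℂ}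
    (hZ : Z ∈ Submodule.span ℂ (L : Set (Matrix n n ℂ)))
    (hW : W ∈ Submodule.span ℂ (L : Set (Matrix n n ℂ))) :
    Z * W - W * Z ∈ Submodule.span ℂ (L : Set (Matrix n n ℂ)) := by
  let B : Matrix n n ℂ →ₗ[ℂ] Matrix n n ℂ →ₗ[ℂ] Matrix n n ℂ :=
    LinearMap.mul ℂ (Matrix n n ℂ) - (LinearMap.mul ℂ (Matrix n n ℂ)).flip
  have hB : ∀ X Y, B X Y = X * Y - Y * X := fun X Y => rfl
  have h := Submodule.apply_mem_map₂ B hZ hW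
  rw [Submodule.map₂_span_span] at h
  rw [← hB]
  refine (Submodule.span_le.mpr ?_) h
  rintro _ ⟨X, hX, Y, hY, rfl⟩
  exact Submodule.subset_span (hbr X hX Y hY)

omit [Fintype n] in
/-- The complex span of a subspace of skew-Hermitian matrices is stable under `Z ↦ −Zᴴ`.
[folklore] -/
theorem neg_star_mem_span {L : Submodule ℝ (Matrix n n ℂ)} (hskew : ∀ X ∈ L, star X = -X)
    {Z : Matrix n n ℂ} (hZ : Z ∈ Submodule.span ℂ (L : Set (Matrix n n ℂ))) :
    -star Z ∈ Submodule.span ℂ (L : Set (Matrix n n ℂ)) := by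
  induction hZ using Submodule.span_induction with
  | mem X hX => rw [hskew X hX, neg_neg]; exact Submodule.subset_span hX
  | zero => simp
  | add X Y _ _ hX hY => rw [star_add, neg_add]; exact Submodule.add_mem _ hX hY
  | smul c X _ hX => rw [star_smul, ← smul_neg]; exact Submodule.smul_mem _ _ hX

/-! ### The weight spaces

They are handled through a family `E` of `ℂ`-submodules with the membership characterisation
`hE : Z ∈ E w ↔ Z ∈ L_ℂ ∧ ∀ H : A, HZ − ZH = (w(H)·i) • Z`. -/

/-- `[E_w, E_{w'}] ⊆ E_{w+w'}` (Jacobi / derivation property of `ad H`). [folklore] -/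
theorem bracket_mem_wt {L A : Submodule ℝ (Matrix n n ℂ)}
    {E : (↥A →ₗ[ℝ] ℝ) → Submodule ℂ (Matrix n n ℂ)}
    (hE : ∀ w Z, Z ∈ E w ↔ Z ∈ Submodule.span ℂ (L : Set (Matrix n n ℂ)) ∧
      ∀ H : ↥A, (H : Matrix n n ℂ) * Z - Z * (H : Matrix n n ℂ) =
        ((((w H : ℝ) : ℂ)) * Complex.I) • Z)
    (hbr : ∀ X ∈ L, ∀ Y ∈ L, X * Y - Y * X ∈ L) {w w' : ↥A →ₗ[ℝ] ℝ} {Z W : Matrix n n ℂ}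
    (hZ : Z ∈ E w) (hW : W ∈ E w') : Z * W - W * Z ∈ E (w + w') := by
  obtain ⟨hZV, hZ⟩ := (hE w Z).mp hZ
  obtain ⟨hWV, hW⟩ := (hE w' W).mp hW
  refine (hE _ _).mpr ⟨bracket_mem_span hbr hZV hWV, fun H => ?_⟩
  have key : (H : Matrix n n ℂ) * (Z * W - W * Z) - (Z * W - W * Z) * H =
      ((H : Matrix n n ℂ) * Z - Z * H) * W + Z * ((H : Matrix n n ℂ) * W - W * H) -
        (((H : Matrix n n ℂ) * W - W * H) * Z + W * ((H : Matrix n n ℂ) * Z - Z * H)) := by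
    noncomm_ring
  rw [key, hZ H, hW H]
  simp only [smul_mul_assoc, mul_smul_comm, LinearMap.add_apply, Complex.ofReal_add, add_mul,
    add_smul, smul_sub]
  abel

/-- `σ E_w ⊆ E_{−w}` for the conjugation `σ Z = −Zᴴ` (which fixes `L ⊆ 𝔲(n)` pointwise).
[folklore] -/
theorem neg_star_mem_wt {L A : Submodule ℝ (Matrix n n ℂ)}
    {E : (↥A →ₗ[ℝ] ℝ) → Submodule ℂ (Matrix n n ℂ)}
    (hE : ∀ w Z, Z ∈ E w ↔ Z ∈ Submodule.span ℂ (L : Set (Matrix n n ℂ)) ∧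
      ∀ H : ↥A, (H : Matrix n n ℂ) * Z - Z * (H : Matrix n n ℂ) =
        ((((w H : ℝ) : ℂ)) * Complex.I) • Z)
    (hskew : ∀ X ∈ L, star X = -X) (hAL : A ≤ L) {w : ↥A →ₗ[ℝ] ℝ} {Z : Matrix n n ℂ}
    (hZ : Z ∈ E w) : -star Z ∈ E (-w) := by
  obtain ⟨hZV, hZ⟩ := (hE w Z).mp hZ
  refine (hE _ _).mpr ⟨neg_star_mem_span hskew hZV, fun H => ?_⟩
  have hH : star (H : Matrix n n ℂ) = -(H : Matrix n n ℂ) := hskew _ (hAL H.2)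
  have hc : star ((((w H : ℝ) : ℂ)) * Complex.I) = -((((w H : ℝ) : ℂ)) * Complex.I) := by
    rw [star_mul', Complex.star_def, Complex.conj_ofReal, Complex.conj_I, mul_neg]
  have h1 := congrArg star (hZ H)
  rw [star_sub, star_mul, star_mul, hH, star_smul, hc, mul_neg, neg_mul, sub_neg_eq_add,
    neg_add_eq_sub, neg_smul] at h1
  rw [mul_neg, neg_mul, sub_neg_eq_add, neg_add_eq_sub, ← neg_sub, h1, neg_neg,
    LinearMap.neg_apply, Complex.ofReal_neg, neg_mul, smul_neg, neg_smul, neg_neg]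

/-- The weight spaces are independent: they sit in the joint (generalised) eigenspaces of the
commuting family `ad H_i` (`H_i` a basis of `A`), which are independent, and a weight is determined
by its values on the basis. [folklore] -/
theorem iSupIndep_wt {L A : Submodule ℝ (Matrix n n ℂ)}
    {E : (↥A →ₗ[ℝ] ℝ) → Submodule ℂ (Matrix n n ℂ)}
    (hE : ∀ w Z, Z ∈ E w ↔ Z ∈ Submodule.span ℂ (L : Set (Matrix n n ℂ)) ∧
      ∀ H : ↥A, (H : Matrix n n ℂ) * Z - Z * (H : Matrix n n ℂ) =
        ((((w H : ℝ) : ℂ)) * Complex.I) • Z)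
    (hA : ∀ H ∈ A, ∀ H' ∈ A, H * H' = H' * H) : iSupIndep E := by
  let b := Module.finBasis ℝ ↥A
  let f : Fin (Module.finrank ℝ ↥A) → Module.End ℂ (Matrix n n ℂ) :=
    fun i => LinearMap.mulLeft ℂ (b i : Matrix n n ℂ) - LinearMap.mulRight ℂ (b i : Matrix n n ℂ)
  have hf : ∀ i j φ, Set.MapsTo (f i) ((f j).maxGenEigenspace φ) ((f j).maxGenEigenspace φ) :=
    fun i j φ => Module.End.mapsTo_maxGenEigenspace_of_comm
      (commute_ad (hA _ (b j).2 _ (b i).2)) φ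
  have hind := Module.End.independent_iInf_maxGenEigenspace_of_forall_mapsTo f hf
  -- the eigenvalue strings `c w = (i w(H_i))_i` determine the weight `w`
  let c : (↥A →ₗ[ℝ] ℝ) → Fin (Module.finrank ℝ ↥A) → ℂ :=
    fun w i => (((w (b i) : ℝ) : ℂ)) * Complex.I
  have hc : Function.Injective c := by
    intro w w' h
    refine b.ext fun i => ?_
    have hi := congrFun h i
    simpa [c, Complex.I_ne_zero, Complex.ofReal_inj] using hi
  refine (hind.comp hc).mono fun w Z hZ => ?_
  show Z ∈ ⨅ i, (f i).maxGenEigenspace (c w i)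
  refine (Submodule.mem_iInf _).mpr fun i => Module.End.eigenspace_le_maxGenEigenspace ?_
  rw [Module.End.mem_eigenspace_iff]
  exact ((hE w Z).mp hZ).2 (b i)

/-- The weight spaces exhaust `L_ℂ` (joint diagonalisation of the HS-skew-adjoint commuting family
`ad H_i` on the invariant subspace `L_ℂ`, `le_iSup_jointEigenspace`, plus linearity of
`H ↦ [H, Z]` to pass from the basis `H_i` to all of `A`). [folklore] -/
theorem iSup_wt {L A : Submodule ℝ (Matrix n n ℂ)}
    {E : (↥A →ₗ[ℝ] ℝ) → Submodule ℂ (Matrix n n ℂ)}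
    (hE : ∀ w Z, Z ∈ E w ↔ Z ∈ Submodule.span ℂ (L : Set (Matrix n n ℂ)) ∧
      ∀ H : ↥A, (H : Matrix n n ℂ) * Z - Z * (H : Matrix n n ℂ) =
        ((((w H : ℝ) : ℂ)) * Complex.I) • Z)
    (hbr : ∀ X ∈ L, ∀ Y ∈ L, X * Y - Y * X ∈ L) (hskew : ∀ X ∈ L, star X = -X)
    (hAL : A ≤ L) (hA : ∀ H ∈ A, ∀ H' ∈ A, H * H' = H' * H) :
    (⨆ w, E w) = Submodule.span ℂ (L : Set (Matrix n n ℂ)) := by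
  refine le_antisymm (iSup_le fun w Z hZ => ((hE w Z).mp hZ).1) ?_
  let b := Module.finBasis ℝ ↥A
  let f : Fin (Module.finrank ℝ ↥A) → Matrix n n ℂ →ₗ[ℂ] Matrix n n ℂ :=
    fun i => LinearMap.mulLeft ℂ (b i : Matrix n n ℂ) - LinearMap.mulRight ℂ (b i : Matrix n n ℂ)
  have h := le_iSup_jointEigenspace (Submodule.span ℂ (L : Set (Matrix n n ℂ))) f
    (fun i Z hZ => bracket_mem_span hbr (Submodule.subset_span (hAL (b i).2)) hZ)
    (fun i j => commute_ad (hA _ (b i).2 _ (b j).2))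
    (fun i Z W => trace_ad_skew (hskew _ (hAL (b i).2)) Z W)
  refine h.trans (iSup_le fun χ => le_trans ?_ (le_iSup _ (b.constr ℝ χ)))
  rintro Z ⟨hZV, hZ⟩
  refine (hE _ _).mpr ⟨hZV, ?_⟩
  have hZb : ∀ i, (b i : Matrix n n ℂ) * Z - Z * (b i : Matrix n n ℂ) =
      (((χ i : ℝ) : ℂ) * Complex.I) • Z :=
    fun i => Module.End.mem_eigenspace_iff.mp ((Submodule.mem_iInf _).mp hZ i)
  -- both sides are `ℝ`-linear in `H` and agree on the basis `b`
  let g₁ : ↥A →ₗ[ℝ] Matrix n n ℂ := (LinearMap.mulRight ℝ Z - LinearMap.mulLeft ℝ Z) ∘ₗ A.subtype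
  let g₂ : ↥A →ₗ[ℝ] Matrix n n ℂ := (b.constr ℝ χ).smulRight (Complex.I • Z)
  have hg : g₁ = g₂ := by
    refine b.ext fun i => ?_
    simp only [g₁, g₂, LinearMap.comp_apply, Submodule.subtype_apply, LinearMap.sub_apply,
      LinearMap.mulRight_apply, LinearMap.mulLeft_apply, LinearMap.smulRight_apply,
      Module.Basis.constr_basis]
    rw [hZb i, ← Complex.coe_smul, smul_smul]
  intro H
  have hH := LinearMap.congr_fun hg H
  simp only [g₁, g₂, LinearMap.comp_apply, Submodule.subtype_apply, LinearMap.sub_apply,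
    LinearMap.mulRight_apply, LinearMap.mulLeft_apply, LinearMap.smulRight_apply] at hH
  rw [hH, ← Complex.coe_smul, smul_smul]

/-- Non-degeneracy: an `H ∈ A` killed by every weight commutes with `L`
(since `L ⊆ L_ℂ = ⨆ E_w`). [folklore] -/
theorem commute_of_forall_wt {L A : Submodule ℝ (Matrix n n ℂ)}
    {E : (↥A →ₗ[ℝ] ℝ) → Submodule ℂ (Matrix n n ℂ)}
    (hE : ∀ w Z, Z ∈ E w ↔ Z ∈ Submodule.span ℂ (L : Set (Matrix n n ℂ)) ∧
      ∀ H : ↥A, (H : Matrix n n ℂ) * Z - Z * (H : Matrix n n ℂ) =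
        ((((w H : ℝ) : ℂ)) * Complex.I) • Z)
    (hbr : ∀ X ∈ L, ∀ Y ∈ L, X * Y - Y * X ∈ L) (hskew : ∀ X ∈ L, star X = -X) (hAL : A ≤ L)
    (hA : ∀ H ∈ A, ∀ H' ∈ A, H * H' = H' * H) (H : ↥A) (hH : ∀ w, E w ≠ ⊥ → w H = 0) :
    ∀ X ∈ L, (H : Matrix n n ℂ) * X = X * (H : Matrix n n ℂ) := by
  intro X hX
  have hXV : X ∈ ⨆ w, E w := by
    rw [iSup_wt hE hbr hskew hAL hA]; exact Submodule.subset_span hX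
  rw [← sub_eq_zero]
  refine Submodule.iSup_induction E
    (motive := fun X => (H : Matrix n n ℂ) * X - X * (H : Matrix n n ℂ) = 0) hXV ?_ (by simp) ?_
  · intro w Z hZ
    by_cases hZ0 : Z = 0
    · simp [hZ0]
    · rw [((hE w Z).mp hZ).2 H, hH w ((Submodule.ne_bot_iff _).mpr ⟨Z, hZ, hZ0⟩),
        Complex.ofReal_zero, zero_mul, zero_smul]
  · intro Z W hZ hW
    rw [mul_add, add_mul, add_sub_add_comm, hZ, hW, add_zero]

end WeightDecomp

open WeightDecomp in
/-- **Stub (LINEAR ALGEBRA — joint weight decomposition of the complexification).** Let `L` be a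
real subspace of `M_N(ℂ)` closed under the commutator and consisting of skew-Hermitian matrices, with the
real-structure facts of its complex span `L_ℂ = L ⊕ iL` given, and `A ≤ L` abelian. Then `L_ℂ` is the
INDEPENDENT finite sum of the joint eigenspaces `E_w = {Z ∈ L_ℂ : [H, Z] = i·w(H) Z ∀ H ∈ A}` of `ad A`,
indexed by real weights `w ∈ A*` (each `ad H`, `H` skew-Hermitian, is skew-adjoint for the Hilbert–Schmidt
inner product, so the commuting family `{i·ad H}` is jointly diagonalisable with real spectrum —
`LinearMap.IsSymmetric.iSup_iInf_eq_top_of_commute`), with `[E_w, E_w'] ⊆ E_{w+w'}` (Jacobi),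
`σ E_w = E_{−w}` for the conjugation `σ Z = −Zᴴ` of `M_N(ℂ) = 𝔲(N) ⊕ i𝔲(N)`, and non-degeneracy: an
`H ∈ A` killed by every weight commutes with `L`. [folklore] -/
theorem stub_weightDecomp :
    ∀ (N : ℕ) (L : Submodule ℝ (Matrix (Fin N) (Fin N) ℂ)),
      (∀ X ∈ L, ∀ Y ∈ L, X * Y - Y * X ∈ L) → (∀ X ∈ L, star X = -X) →
        ((∀ W : Submodule ℝ (Matrix (Fin N) (Fin N) ℂ), (∀ X ∈ W, star X = -X) →
            Module.finrank ℂ ↥(Submodule.span ℂ (W : Set (Matrix (Fin N) (Fin N) ℂ))) = Module.finrank ℝ ↥W) ∧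
          (∀ Z ∈ Submodule.span ℂ (L : Set (Matrix (Fin N) (Fin N) ℂ)), ∃ X ∈ L, ∃ Y ∈ L, Z = X + Complex.I • Y) ∧
          (∀ X ∈ L, ∀ Y ∈ L, X + Complex.I • Y = 0 → X = 0 ∧ Y = 0)) →
        (∀ (A : Submodule ℝ (Matrix (Fin N) (Fin N) ℂ)), A ≤ L → (∀ H ∈ A, ∀ H' ∈ A, H * H' = H' * H) →
          ∃ E : (↥A →ₗ[ℝ] ℝ) → Submodule ℂ (Matrix (Fin N) (Fin N) ℂ),
            (∀ w, (E w : Set (Matrix (Fin N) (Fin N) ℂ)) =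
                {Z | Z ∈ Submodule.span ℂ (L : Set (Matrix (Fin N) (Fin N) ℂ)) ∧
                  ∀ H : ↥A, (H : Matrix (Fin N) (Fin N) ℂ) * Z - Z * (H : Matrix (Fin N) (Fin N) ℂ) =
                    ((((w H : ℝ) : ℂ)) * Complex.I) • Z}) ∧
            iSupIndep E ∧ (⨆ w, E w) = Submodule.span ℂ (L : Set (Matrix (Fin N) (Fin N) ℂ)) ∧
            {w | E w ≠ ⊥}.Finite ∧
            (∀ w w', ∀ Z ∈ E w, ∀ W ∈ E w', Z * W - W * Z ∈ E (w + w')) ∧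
            (∀ w, ∀ Z ∈ E w, -star Z ∈ E (-w)) ∧
            (∀ H : ↥A, (∀ w, E w ≠ ⊥ → w H = 0) → ∀ X ∈ L, (H : Matrix (Fin N) (Fin N) ℂ) * X = X * (H : Matrix (Fin N) (Fin N) ℂ))) := by
  intro N L hbr hskew _ A hAL hA
  -- the weight spaces `E_w`, as `ℂ`-submodules with the displayed carrier
  let E : (↥A →ₗ[ℝ] ℝ) → Submodule ℂ (Matrix (Fin N) (Fin N) ℂ) := fun w =>
    { carrier := {Z | Z ∈ Submodule.span ℂ (L : Set (Matrix (Fin N) (Fin N) ℂ)) ∧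
        ∀ H : ↥A, (H : Matrix (Fin N) (Fin N) ℂ) * Z - Z * (H : Matrix (Fin N) (Fin N) ℂ) =
          ((((w H : ℝ) : ℂ)) * Complex.I) • Z}
      add_mem' := by
        rintro Z W ⟨hZ, hZ'⟩ ⟨hW, hW'⟩
        refine ⟨add_mem hZ hW, fun H => ?_⟩
        rw [mul_add, add_mul, smul_add, ← hZ' H, ← hW' H]
        abel
      zero_mem' := ⟨zero_mem _, fun H => by simp⟩
      smul_mem' := by
        rintro c Z ⟨hZ, hZ'⟩
        refine ⟨Submodule.smul_mem _ c hZ, fun H => ?_⟩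
        rw [mul_smul_comm, smul_mul_assoc, ← smul_sub, hZ' H, smul_comm] }
  have hE : ∀ w Z, Z ∈ E w ↔ Z ∈ Submodule.span ℂ (L : Set (Matrix (Fin N) (Fin N) ℂ)) ∧
      ∀ H : ↥A, (H : Matrix (Fin N) (Fin N) ℂ) * Z - Z * (H : Matrix (Fin N) (Fin N) ℂ) =
        ((((w H : ℝ) : ℂ)) * Complex.I) • Z := fun _ _ => Iff.rfl
  exact ⟨E, fun _ => rfl, iSupIndep_wt hE hA, iSup_wt hE hbr hskew hAL hA,
    WellFoundedGT.finite_ne_bot_of_iSupIndep (iSupIndep_wt hE hA),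
    fun _ _ _ hZ _ hW => bracket_mem_wt hE hbr hZ hW, fun _ _ hZ => neg_star_mem_wt hE hskew hAL hZ,
    fun H hH => commute_of_forall_wt hE hbr hskew hAL hA H hH⟩

end Summit.QuantumFields.YangMills.Theorems.BrascampLiebVacuumSC

end
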